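import Summits.AtomisticToContinuum.Crystallization.Theorems.GappedShellCensusCleanLimitsHaveWindowsCleanChartTSteps1
import Summits.AtomisticToContinuum.Crystallization.Theorems.GappedShellCensusCleanLimitsHaveWindowsCleanChartTSteps2
import Summits.AtomisticToContinuum.Crystallization.Theorems.GappedShellCensusCleanLimitsHaveWindowsCleanChartTSteps3
import Summits.AtomisticToContinuum.Crystallization.Theorems.GappedShellCensusCleanLimitsHaveWindowsCleanChartTSteps7
import Summits.AtomisticToContinuum.Crystallization.Theorems.GappedShellCensusCleanLimitsHaveWindowsCleanChartTAttach1
import Summits.AtomisticToContinuum.Crystallization.Theorems.GappedShellCensusCleanLimitsHaveWindowsCleanChartTAttach2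
import Summits.AtomisticToContinuum.Crystallization.Theorems.GappedShellCensusCleanLimitsHaveWindowsCleanChartTComm1
import Summits.AtomisticToContinuum.Crystallization.Theorems.PalmUnimodularRigidityShellsToBarlowChartTransportComm2

/-!
# `CleanLimitsHaveWindows` (stmt-AtomisticToContinuum-15932), line `Sketch` — stub K1 (`stub_cleanChart`):
# the transport development re-run on CLEAN charts — copy of `PalmUnimodularRigidityShellsToBarlowChartTransportComm2`

This file is a mechanical copy of `Theorems/PalmUnimodularRigidityShellsToBarlowChartTransportComm2.lean` (crux `ShellsToBarlowChart`,
route `PalmUnimodularRigidity`; original title: Line `develop-the-model-growth-descent` (crux `ShellsToBarlowChart`, stmt-AtomisticToContinuum-9227): commutation of `V` with `I` and `J` (part 2/3))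
in which the chart hypothesis `hch : ∀ z ∈ S, IsZChart S z (ac z) (Pc z) (Ac z) (nb z)` (integer charts with
`1 %` closeness) is replaced by the CLEAN-CHART hypothesis: at every site a labelling of the bonded neighbours
by `fcc3Int`/`hcpInt`, bijective, with bonds among neighbours = label pairs at squared distance `18`, together
with the TRANSFER property across every bond (proved for clean sets at matching radius `1/5` in
`…CleanChartTransfer`).  The original development uses its metric hypothesis only through the transfer
lemma, so all proofs go through verbatim; declarations live in the sub-namespace `….Clean` and shadow the
originals, the `hch`-free lemmas of the original file are reused, not restated.  All `[folklore]`.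
-/

noncomputable section

namespace Summit.AtomisticToContinuum.Crystallization.Theorems.PalmUnimodularRigidityShellsToBarlowChart.Clean

open Literature.Geometry.DiscreteGeometry Literature.MathematicalPhysics.StatisticalMechanics
open Summit.AtomisticToContinuum.Crystallization.Theorems.ShellsToBarlowChartNegative

variable {S : Set (EuclideanSpace ℝ (Fin 3))} {Pc : (EuclideanSpace ℝ (Fin 3)) → Finset (Fin 3 → ℤ)}
  {nb : (EuclideanSpace ℝ (Fin 3)) → (Fin 3 → ℤ) → (EuclideanSpace ℝ (Fin 3))}

/-- **`V ∘ I = I ∘ V`, the second direction.**  With `u' = (V (I g)).pt` and `uJ = (V (J g)).pt`,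
the label of `uJ` at `u'` is `(V (I g)).t₂ − (V (I g)).t₁`: in the model `uJ = (k+1, i, j+1)` is
the `(t₂ − t₁)`-neighbour of `u' = (k+1, i+1, j)`.  Needs the in-layer commutation at `g`.
[folklore] -/
theorem Vstep_Istep_side (hch : ((∀ z ∈ S, (Pc z = fcc3Int ∨ Pc z = hcpInt) ∧ Set.BijOn (nb z) (↑(Pc z) : Set (Fin 3 → ℤ)) {y | y ∈ S ∧ (0 < dist z y ∧ dist z y ≤ 28 / 25)} ∧ (∀ t ∈ Pc z, ∀ t' ∈ Pc z, ((0 < dist (nb z t) (nb z t') ∧ dist (nb z t) (nb z t') ≤ 28 / 25) ↔ sqNormInt (t - t') = 18))) ∧ (∀ x ∈ S, ∀ y ∈ S, (0 < dist x y ∧ dist x y ≤ 28 / 25) → ∀ t ∈ Pc x, ∀ t' ∈ Pc x, ∀ u ∈ Pc y, ∀ u' ∈ Pc y, nb y u = nb x t → nb y u' = nb x t' → sqNormInt (u - u') = sqNormInt (t - t')))) {x : (EuclideanSpace ℝ (Fin 3))} (hx : x ∈ S) {t₁ t₂ : Fin 3 → ℤ} {U : Finset (Fin 3 → ℤ)}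 (hU : IsFrame (Pc x) t₁ t₂ U) (hI : IsFrame (Pc (nb x t₁)) (Istep Pc nb ⟨x, t₁, t₂, U⟩).t₁ (Istep Pc nb ⟨x, t₁, t₂, U⟩).t₂ (Istep Pc nb ⟨x, t₁, t₂, U⟩).U) (hJ : IsFrame (Pc (nb x t₂)) (Jstep Pc nb ⟨x, t₁, t₂, U⟩).t₁ (Jstep Pc nb ⟨x, t₁, t₂, U⟩).t₂ (Jstep Pc nb ⟨x, t₁, t₂, U⟩).U) (hIi : IsFrame (Pc (nb x (-t₁))) (IinvStep Pc nb ⟨x, t₁, t₂, U⟩).t₁ (IinvStep Pc nb ⟨x, t₁, t₂, U⟩).t₂ (IinvStep Pc nb ⟨x, t₁, t₂, U⟩).U) (hJi : IsFrame (Pc (nb x (-t₂))) (JinvStep Pc nb ⟨x, t₁, t₂, U⟩).t₁ (JinvStep Pc nb ⟨x, t₁, t₂, U⟩).t₂ (JinvStep Pc nb ⟨x, t₁, t₂, U⟩).U) (hII : IsFrame (Pc (nb (nb x t₁) (Istep Pc nb ⟨x, t₁, t₂, U⟩).t₁)) (Istep Pc nb (Istep Pc nb ⟨x, t₁, t₂,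 U⟩)).t₁ (Istep Pc nb (Istep Pc nb ⟨x, t₁, t₂, U⟩)).t₂ (Istep Pc nb (Istep Pc nb ⟨x, t₁, t₂, U⟩)).U) (hJI : IsFrame (Pc (nb (nb x t₁) (Istep Pc nb ⟨x, t₁, t₂, U⟩).t₂)) (Jstep Pc nb (Istep Pc nb ⟨x, t₁, t₂, U⟩)).t₁ (Jstep Pc nb (Istep Pc nb ⟨x, t₁, t₂, U⟩)).t₂ (Jstep Pc nb (Istep Pc nb ⟨x, t₁, t₂, U⟩)).U) (hIiI : IsFrame (Pc (nb (nb x t₁) (-(Istep Pc nb ⟨x, t₁, t₂, U⟩).t₁))) (IinvStep Pc nb (Istep Pc nb ⟨x, t₁, t₂, U⟩)).t₁ (IinvStep Pc nb (Istep Pc nb ⟨x, t₁, t₂, U⟩)).t₂ (IinvStep Pc nb (Istep Pc nb ⟨x, t₁, t₂, U⟩)).U) (hJiI : IsFrame (Pc (nb (nb x t₁) (-(Istep Pc nb ⟨x, t₁, t₂, U⟩).t₂))) (JinvStep Pc nb (Istep Pc nb ⟨x, t₁, t₂, U⟩)).t₁ (JinvStep Pc nb (Istep Pc nb ⟨x,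 t₁, t₂, U⟩)).t₂ (JinvStep Pc nb (Istep Pc nb ⟨x, t₁, t₂, U⟩)).U) (hcomm : Istep Pc nb (Jstep Pc nb ⟨x, t₁, t₂, U⟩) = Jstep Pc nb (Istep Pc nb ⟨x, t₁, t₂, U⟩)) : zlab Pc nb (Vstep Pc nb (Istep Pc nb ⟨x, t₁, t₂, U⟩)).pt (Vstep Pc nb (Jstep Pc nb ⟨x, t₁, t₂, U⟩)).pt = (Vstep Pc nb (Istep Pc nb ⟨x, t₁, t₂, U⟩)).t₂ - (Vstep Pc nb (Istep Pc nb ⟨x, t₁, t₂, U⟩)).t₁ ∧ (0 < dist (Vstep Pc nb (Istep Pc nb ⟨x, t₁, t₂, U⟩)).pt (Vstep Pc nb (Jstep Pc nb ⟨x, t₁, t₂, U⟩)).pt ∧ dist (Vstep Pc nb (Istep Pc nb ⟨x, t₁, t₂, U⟩)).pt (Vstep Pc nb (Jstep Pc nb ⟨x, t₁, t₂, U⟩)).pt ≤ 28 / 25) := by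
  have hregI := hregI_of_valid (Pc := Pc) (nb := nb) hI
  have hregJ := hregJ_of_valid (Pc := Pc) (nb := nb) hJ
  obtain ⟨hyS, hbxy, hwP, hwx, hvP, hvnb, -, -, -, hκ, -, hframe, hparI, -⟩ := Istep_spec hch hx hU hregI
  obtain ⟨hyJS, -, -, -, -, -, -, -, -, -, -, hJframe, hparJ, -⟩ := Jstep_spec hch hx hU hregJ
  obtain ⟨hcU, huS, hbu, hξP, hξx, hframeV, -, hbr⟩ := Vstep_spec hch hx hU hI hJ hIi hJi
  have hPx := pattern_cases hch hx
  have hPy := pattern_cases hch hyS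
  obtain ⟨h12, hhex, hUP, -, -⟩ := id hU
  have ht₁ : t₁ ∈ Pc x := hhex (mem_hexLabels_iff.2 (Or.inl rfl))
  have ht₂ : t₂ ∈ Pc x := hhex (mem_hexLabels_iff.2 (Or.inr (Or.inl rfl)))
  have ht12 : t₁ - t₂ ∈ Pc x :=
    hhex (mem_hexLabels_iff.2 (Or.inr (Or.inr (Or.inr (Or.inr (Or.inr rfl))))))
  set c := apexOf t₁ t₂ U with hc_def
  have hcP : c ∈ Pc x := hUP hcU
  -- the frames `I g = ⟨y, a', b', U'⟩` and `J g = ⟨yJ, aJ, bJ, UJ⟩`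
  set a' := (Istep Pc nb ⟨x, t₁, t₂, U⟩).t₁ with ha'
  set b' := (Istep Pc nb ⟨x, t₁, t₂, U⟩).t₂ with hb'
  set U' := (Istep Pc nb ⟨x, t₁, t₂, U⟩).U with hU'
  have hIeq : Istep Pc nb ⟨x, t₁, t₂, U⟩ = ⟨nb x t₁, a', b', U'⟩ := rfl
  set aJ := (Jstep Pc nb ⟨x, t₁, t₂, U⟩).t₁ with haJ
  set bJ := (Jstep Pc nb ⟨x, t₁, t₂, U⟩).t₂ with hbJ_def
  set UJ := (Jstep Pc nb ⟨x, t₁, t₂, U⟩).U with hUJ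
  have hJeq : Jstep Pc nb ⟨x, t₁, t₂, U⟩ = ⟨nb x t₂, aJ, bJ, UJ⟩ := rfl
  rw [hIeq] at hII hJI hIiI hJiI hcomm ⊢
  rw [hJeq] at hcomm ⊢
  obtain ⟨hc'U, hu'S, hbu', hξ'P, hξ'x, hframeV', -, hbr'⟩ :=
    Vstep_spec hch hyS hframe hII hJI hIiI hJiI
  obtain ⟨h12', hhex', hUP', -, -⟩ := id hframe
  have ha'P : a' ∈ Pc (nb x t₁) := hhex' (mem_hexLabels_iff.2 (Or.inl rfl))
  have hb'P : b' ∈ Pc (nb x t₁) := hhex' (mem_hexLabels_iff.2 (Or.inr (Or.inl rfl)))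
  set c' := apexOf a' b' U' with hc'_def
  have hc'P : c' ∈ Pc (nb x t₁) := hUP' hc'U
  have hV'pt : (Vstep Pc nb ⟨nb x t₁, a', b', U'⟩).pt = nb (nb x t₁) c' := rfl
  rw [hV'pt] at *
  set u' := nb (nb x t₁) c' with hu'_def
  set t₁'' := (Vstep Pc nb ⟨nb x t₁, a', b', U'⟩).t₁ with ht₁''_def
  set t₂'' := (Vstep Pc nb ⟨nb x t₁, a', b', U'⟩).t₂ with ht₂''_def
  have hPu' := pattern_cases hch hu'S
  obtain ⟨h12'', hhex'', -, -, -⟩ := id hframeV'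
  have ht21P : t₂'' - t₁'' ∈ Pc u' := hhex'' (mem_hexLabels_iff.2 (Or.inr (Or.inr (Or.inl rfl))))
  have Dt12 : sqNormInt (t₁'' - t₂'') = 18 := h12''
  -- the point `uJ = (V (J g)).pt`
  set cJ := apexOf aJ bJ UJ with hcJ_def
  have hVJpt : (Vstep Pc nb ⟨nb x t₂, aJ, bJ, UJ⟩).pt = nb (nb x t₂) cJ := rfl
  rw [hVJpt]
  rcases hbr with ⟨hpar, -, -, -, -⟩ | ⟨hpar, -, -, -, -⟩
  · /- EVEN: everything is read in the chart of `x'' = JIx = nb y b'` -/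
    have hpar' : frameParity a' b' U' = 1 := hparI.trans hpar
    have hparJ' : frameParity aJ bJ UJ = 1 := hparJ.trans hpar
    rcases hbr' with ⟨-, hL', hnI', hnJ', -⟩ | ⟨hpar'', -, -, -, -⟩
    swap
    · rw [hpar'] at hpar''; norm_num at hpar''
    -- the frame `J (I g) = ⟨x'', a'', b'', U''⟩`
    set a'' := (Jstep Pc nb ⟨nb x t₁, a', b', U'⟩).t₁ with ha''
    set b'' := (Jstep Pc nb ⟨nb x t₁, a', b', U'⟩).t₂ with hb''
    set U'' := (Jstep Pc nb ⟨nb x t₁, a', b', U'⟩).U with hU''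
    have hJIeq : Jstep Pc nb ⟨nb x t₁, a', b', U'⟩ = ⟨nb (nb x t₁) b', a'', b'', U''⟩ := rfl
    have hregJI := hregJ_of_valid (Pc := Pc) (nb := nb) hJI
    obtain ⟨hx''S, hbyx'', hw''P, hw''y, hv''P, hv''nb, -, -, -, -, -, hframe'', hpar''I, -⟩ :=
      Jstep_spec hch hyS hframe hregJI
    have hpar''' : frameParity a'' b'' U'' = 1 := hpar''I.trans hpar'
    have hPx'' := pattern_cases hch hx''S
    obtain ⟨h12x, hhexx, -, -, -⟩ := id hframe''
    have ha''P : a'' ∈ Pc (nb (nb x t₁) b') := hhexx (mem_hexLabels_iff.2 (Or.inl rfl))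
    have hb''P : b'' ∈ Pc (nb (nb x t₁) b') := hhexx (mem_hexLabels_iff.2 (Or.inr (Or.inl rfl)))
    obtain ⟨-, hc''P, hc''off, hc1'', hc2'', hE''⟩ := even_form_of_parity hPx'' hframe'' hpar'''
    set c'' := apexOf a'' b'' U'' with hc''_def
    -- `u' = nb x'' (c'' − b'')`
    obtain ⟨hattJ, hlabJ⟩ := attach_J_even hch hyS hframe hpar' hregJI
    rw [hJIeq] at hattJ hlabJ
    have hu'x'' : nb (nb (nb x t₁) b') (c'' - b'') = u' := hattJ
    -- `uJ = nb x'' (c'' − a'')` through the in-layer commutation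
    have hpteq : nb (nb x t₂) aJ = nb (nb x t₁) b' := congrArg ZFrame.pt hcomm
    have hregIJ : Pc (nb (nb x t₂) aJ) = fcc3Int ∨ Pc (nb x t₂) = hcpInt ∨
        (-zlab Pc nb (nb (nb x t₂) aJ) (nb x t₂) ∈ Pc (nb (nb x t₂) aJ) ∧
          -zlab Pc nb (nb (nb x t₂) aJ) (nb (nb x t₂) bJ) ∈ Pc (nb (nb x t₂) aJ)) := by
      apply hregI_of_valid (Pc := Pc) (nb := nb)
      rw [hcomm, hpteq]; exact hJI
    obtain ⟨hattI, hlabI⟩ := attach_I_even hch hyJS hJframe hparJ' hregIJ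
    rw [hcomm] at hattI hlabI
    rw [hpteq] at hattI hlabI
    have huJx'' : nb (nb (nb x t₁) b') (c'' - a'') = nb (nb x t₂) cJ := hattI
    -- bonds at `x''`
    have hbu'uJ : 0 < dist u' (nb (nb x t₂) cJ) ∧ dist u' (nb (nb x t₂) cJ) ≤ 28 / 25 := by
      have := (bond_nb_iff hch hx''S hc2'' hc1'').2 (by
        rw [show c'' - b'' - (c'' - a'') = a'' - b'' by abel]; exact h12x)
      rwa [hu'x'', huJx''] at this
    have hbx''u' : 0 < dist (nb (nb x t₁) b') u' ∧ dist (nb (nb x t₁) b') u' ≤ 28 / 25 := by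
      rw [← hu'x'']; exact (nb_mem hch hx''S hc2'').2
    have huJS : nb (nb x t₂) cJ ∈ S := by rw [← huJx'']; exact (nb_mem hch hx''S hc1'').1
    have hβ := zlab_spec hch hu'S huJS hbu'uJ
    -- `ζ' = ξ' + t₂''` labels `x''`, `η' = ξ' + t₁''` labels `IIx = nb y a' = nb x'' (a'' − b'')`
    have hζ'P : zlab Pc nb u' (nb x t₁) + t₂'' ∈ Pc u' := by
      have : zlab Pc nb u' (nb x t₁) + t₂'' ∈ lowerCap (Pc u') t₁'' t₂''
          (Vstep Pc nb ⟨nb x t₁, a', b', U'⟩).U := by rw [hL']; simp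
      exact (mem_lowerCap_iff.1 this).1
    have hη'P : zlab Pc nb u' (nb x t₁) + t₁'' ∈ Pc u' := by
      have : zlab Pc nb u' (nb x t₁) + t₁'' ∈ lowerCap (Pc u') t₁'' t₂''
          (Vstep Pc nb ⟨nb x t₁, a', b', U'⟩).U := by rw [hL']; simp
      exact (mem_lowerCap_iff.1 this).1
    have hζ' : zlab Pc nb u' (nb (nb x t₁) b') = zlab Pc nb u' (nb x t₁) + t₂'' := by
      rw [← hnJ']; exact zlab_nb hch hu'S hζ'P
    have hη' : zlab Pc nb u' (nb (nb x t₁) a') = zlab Pc nb u' (nb x t₁) + t₁'' := by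
      rw [← hnI']; exact zlab_nb hch hu'S hη'P
    have hbu'II : 0 < dist u' (nb (nb x t₁) a') ∧ dist u' (nb (nb x t₁) a') ≤ 28 / 25 := by
      rw [← hnI']; exact (nb_mem hch hu'S hη'P).2
    have hIIx'' : nb (nb (nb x t₁) b') (a'' - b'') = nb (nb x t₁) a' := by
      have e : a'' - b'' = zlab Pc nb (nb (nb x t₁) b') (nb (nb x t₁) a') := by
        show (zlab Pc nb (nb (nb x t₁) b') (nb (nb x t₁) a') - zlab Pc nb (nb (nb x t₁) b') (nb x t₁)) -
          -zlab Pc nb (nb (nb x t₁) b') (nb x t₁) = _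
        abel
      rw [e]; exact hv''nb
    have hab''P : a'' - b'' ∈ Pc (nb (nb x t₁) b') :=
      hhexx (mem_hexLabels_iff.2 (Or.inr (Or.inr (Or.inr (Or.inr (Or.inr rfl))))))
    -- distances at `u'`
    have Dβζ : sqNormInt (zlab Pc nb u' (nb (nb x t₂) cJ) - zlab Pc nb u' (nb (nb x t₁) b')) = 18 := by
      have h := transfer_nb_centre hch hx''S hu'S hbx''u' hc1'' (by rw [huJx'']; exact hbu'uJ)
      rw [huJx''] at h
      rw [h]; exact sqNormInt_of_label hch hx''S hc1''
    have Dβη : sqNormInt (zlab Pc nb u' (nb (nb x t₂) cJ) - zlab Pc nb u' (nb (nb x t₁) a')) = 54 := by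
      have h := transfer_nb_nb hch hx''S hu'S hbx''u' hc1'' hab''P (by rw [huJx'']; exact hbu'uJ)
        (by rw [hIIx'']; exact hbu'II)
      rw [huJx'', hIIx''] at h
      rw [h]
      exact (dist_evenCap_ca (Pc (nb (nb x t₁) b')) hPx'' a'' ha''P b'' hb''P c'' hc''P h12x hhexx
        hc''off hc1'' hc2'').2.2.2.2.2
    have hβeq : zlab Pc nb u' (nb (nb x t₂) cJ) = t₂'' - t₁'' := by
      have h := label_third_vertex (Pc u') hPu' (zlab Pc nb u' (nb x t₁) + t₁'') hη'P
        (zlab Pc nb u' (nb x t₁) + t₂'') hζ'P _ hβ.1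
        (by rw [show zlab Pc nb u' (nb x t₁) + t₁'' - (zlab Pc nb u' (nb x t₁) + t₂'') = t₁'' - t₂'' by abel]
            exact Dt12)
        (by rw [← hζ']; exact Dβζ) (by rw [← hη']; exact Dβη)
        (by rw [show zlab Pc nb u' (nb x t₁) + t₂'' - (zlab Pc nb u' (nb x t₁) + t₁'') = t₂'' - t₁'' by abel]
            exact ht21P)
      rw [h]; abel
    exact ⟨hβeq, hbu'uJ⟩
  · /- ODD: everything is read in the chart of `x` -/
    have hpar' : frameParity a' b' U' = -1 := hparI.trans hpar
    rcases hbr' with ⟨hpar'', -, -, -, -⟩ | ⟨-, hL', hnI', hnJ', -⟩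
    · rw [hpar'] at hpar''; norm_num at hpar''
    obtain ⟨-, -, hcoff, hc1, hc2, hO⟩ := odd_form_of_parity hPx hU hpar
    obtain ⟨hattI, -⟩ := attach_I_odd hch hx hU hpar hregI
    obtain ⟨hattJ, -⟩ := attach_J_odd hch hx hU hpar hregJ
    rw [hIeq] at hattI
    rw [hJeq] at hattJ
    have hu'x : nb x (c + t₁) = u' := hattI.symm
    have huJx : nb (nb x t₂) cJ = nb x (c + t₂) := hattJ
    rw [huJx]
    -- `η'⁻ = ξ' − t₁''` labels `x`, `ζ'⁻ = ξ' − t₂''` labels `z = nb y (−b') = nb x (t₁ − t₂)`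
    have hyx : nb (nb x t₁) (-a') = x := by
      show nb (nb x t₁) (-(-zlab Pc nb (nb x t₁) x)) = x
      rw [neg_neg]; exact hwx
    have hyz : nb (nb x t₁) (-b') = nb x (t₁ - t₂) := by
      have e : -b' = zlab Pc nb (nb x t₁) (nb x (t₁ - t₂)) := by
        rw [hκ]
        show -(zlab Pc nb (nb x t₁) (nb x t₂) - zlab Pc nb (nb x t₁) x) = _
        abel
      rw [e]
      exact (zlab_spec hch hyS (nb_mem hch hx ht12).1 ((bond_nb_iff hch hx ht₁ ht12).2
        (dist_hexagon (Pc x) hPx t₁ ht₁ t₂ ht₂ h12 hhex).2.2.2.2.2.1)).2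
    have hη'P : zlab Pc nb u' (nb x t₁) - t₁'' ∈ Pc u' := by
      have : zlab Pc nb u' (nb x t₁) - t₁'' ∈ lowerCap (Pc u') t₁'' t₂''
          (Vstep Pc nb ⟨nb x t₁, a', b', U'⟩).U := by rw [hL']; simp
      exact (mem_lowerCap_iff.1 this).1
    have hζ'P : zlab Pc nb u' (nb x t₁) - t₂'' ∈ Pc u' := by
      have : zlab Pc nb u' (nb x t₁) - t₂'' ∈ lowerCap (Pc u') t₁'' t₂''
          (Vstep Pc nb ⟨nb x t₁, a', b', U'⟩).U := by rw [hL']; simp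
      exact (mem_lowerCap_iff.1 this).1
    have hη' : zlab Pc nb u' x = zlab Pc nb u' (nb x t₁) - t₁'' := by
      have h : zlab Pc nb u' (nb (nb x t₁) (-a')) = zlab Pc nb u' (nb x t₁) - t₁'' := by
        rw [← hnI']; exact zlab_nb hch hu'S hη'P
      rwa [hyx] at h
    have hζ' : zlab Pc nb u' (nb x (t₁ - t₂)) = zlab Pc nb u' (nb x t₁) - t₂'' := by
      have h : zlab Pc nb u' (nb (nb x t₁) (-b')) = zlab Pc nb u' (nb x t₁) - t₂'' := by
        rw [← hnJ']; exact zlab_nb hch hu'S hζ'P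
      rwa [hyz] at h
    -- bonds at `x`
    have hbxu' : 0 < dist x u' ∧ dist x u' ≤ 28 / 25 := by
      rw [← hu'x]; exact (nb_mem hch hx hc1).2
    have hbu'uJ : 0 < dist u' (nb x (c + t₂)) ∧ dist u' (nb x (c + t₂)) ≤ 28 / 25 := by
      have := (bond_nb_iff hch hx hc1 hc2).2 (by
        rw [show c + t₁ - (c + t₂) = t₁ - t₂ by abel]; exact h12)
      rwa [hu'x] at this
    have hbu'z : 0 < dist u' (nb x (t₁ - t₂)) ∧ dist u' (nb x (t₁ - t₂)) ≤ 28 / 25 := by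
      have h : 0 < dist u' (nb (nb x t₁) (-b')) ∧ dist u' (nb (nb x t₁) (-b')) ≤ 28 / 25 := by
        rw [← hnJ']; exact (nb_mem hch hu'S hζ'P).2
      rwa [hyz] at h
    have huJS : nb x (c + t₂) ∈ S := (nb_mem hch hx hc2).1
    have hβ := zlab_spec hch hu'S huJS hbu'uJ
    have Dβη : sqNormInt (zlab Pc nb u' (nb x (c + t₂)) - zlab Pc nb u' x) = 18 := by
      rw [transfer_nb_centre hch hx hu'S hbxu' hc2 hbu'uJ]; exact sqNormInt_of_label hch hx hc2
    have Dβζ : sqNormInt (zlab Pc nb u' (nb x (c + t₂)) - zlab Pc nb u' (nb x (t₁ - t₂))) = 54 := by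
      rw [transfer_nb_nb hch hx hu'S hbxu' hc2 ht12 hbu'uJ hbu'z]
      exact (dist_oddCap_cb (Pc x) hPx t₁ ht₁ t₂ ht₂ c hcP h12 hhex hcoff hc1 hc2).2.2.2.2.2
    have hβeq : zlab Pc nb u' (nb x (c + t₂)) = t₂'' - t₁'' := by
      have h := label_third_vertex (Pc u') hPu' (zlab Pc nb u' (nb x t₁) - t₂'') hζ'P
        (zlab Pc nb u' (nb x t₁) - t₁'') hη'P _ hβ.1
        (by rw [show zlab Pc nb u' (nb x t₁) - t₂'' - (zlab Pc nb u' (nb x t₁) - t₁'') = t₁'' - t₂'' by abel]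
            exact Dt12)
        (by rw [← hη']; exact Dβη) (by rw [← hζ']; exact Dβζ)
        (by rw [show zlab Pc nb u' (nb x t₁) - t₁'' - (zlab Pc nb u' (nb x t₁) - t₂'') = t₂'' - t₁'' by abel]
            exact ht21P)
      rw [h]; abel
    exact ⟨hβeq, hbu'uJ⟩

/-- **`V ∘ J`, the point** (from `Vstep_Istep_pt` by the swap symmetry): the apex site over `Jx`
is the `t₂`-neighbour of `V g`. [folklore] -/
theorem Vstep_Jstep_pt (hch : ((∀ z ∈ S, (Pc z = fcc3Int ∨ Pc z = hcpInt) ∧ Set.BijOn (nb z) (↑(Pc z) : Set (Fin 3 → ℤ)) {y | y ∈ S ∧ (0 < dist z y ∧ dist z y ≤ 28 / 25)} ∧ (∀ t ∈ Pc z, ∀ t' ∈ Pc z, ((0 < dist (nb z t) (nb z t') ∧ dist (nb z t) (nb z t') ≤ 28 / 25) ↔ sqNormInt (t - t') = 18))) ∧ (∀ x ∈ S, ∀ y ∈ S, (0 < dist x y ∧ dist x y ≤ 28 / 25) → ∀ t ∈ Pc x, ∀ t' ∈ Pc x, ∀ u ∈ Pc y, ∀ u' ∈ Pc y, nb y u =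 nb x t → nb y u' = nb x t' → sqNormInt (u - u') = sqNormInt (t - t')))) {x : (EuclideanSpace ℝ (Fin 3))}
    (hx : x ∈ S) {t₁ t₂ : Fin 3 → ℤ} {U : Finset (Fin 3 → ℤ)} (hU : IsFrame (Pc x) t₁ t₂ U)
    (hI : IsFrame (Pc (nb x t₁)) (Istep Pc nb ⟨x, t₁, t₂, U⟩).t₁ (Istep Pc nb ⟨x, t₁, t₂, U⟩).t₂
      (Istep Pc nb ⟨x, t₁, t₂, U⟩).U)
    (hJ : IsFrame (Pc (nb x t₂)) (Jstep Pc nb ⟨x, t₁, t₂, U⟩).t₁ (Jstep Pc nb ⟨x, t₁, t₂, U⟩).t₂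
      (Jstep Pc nb ⟨x, t₁, t₂, U⟩).U)
    (hIi : IsFrame (Pc (nb x (-t₁))) (IinvStep Pc nb ⟨x, t₁, t₂, U⟩).t₁
      (IinvStep Pc nb ⟨x, t₁, t₂, U⟩).t₂ (IinvStep Pc nb ⟨x, t₁, t₂, U⟩).U)
    (hJi : IsFrame (Pc (nb x (-t₂))) (JinvStep Pc nb ⟨x, t₁, t₂, U⟩).t₁
      (JinvStep Pc nb ⟨x, t₁, t₂, U⟩).t₂ (JinvStep Pc nb ⟨x, t₁, t₂, U⟩).U) :
    (Vstep Pc nb (Jstep Pc nb ⟨x, t₁, t₂, U⟩)).pt =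
        nb (Vstep Pc nb ⟨x, t₁, t₂, U⟩).pt (Vstep Pc nb ⟨x, t₁, t₂, U⟩).t₂ ∧
      (0 < dist (Vstep Pc nb ⟨x, t₁, t₂, U⟩).pt (Vstep Pc nb (Jstep Pc nb ⟨x, t₁, t₂, U⟩)).pt ∧
        dist (Vstep Pc nb ⟨x, t₁, t₂, U⟩).pt (Vstep Pc nb (Jstep Pc nb ⟨x, t₁, t₂, U⟩)).pt ≤ 28 / 25) ∧
      zlab Pc nb (Vstep Pc nb ⟨x, t₁, t₂, U⟩).pt (Vstep Pc nb (Jstep Pc nb ⟨x, t₁, t₂, U⟩)).pt =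
        (Vstep Pc nb ⟨x, t₁, t₂, U⟩).t₂ := by
  have hPx := pattern_cases hch hx
  obtain ⟨hI', hJ', hIi', hJi'⟩ := swap_hyps (Pc := Pc) (nb := nb) hI hJ hIi hJi
  have hU' : IsFrame (Pc x) t₂ t₁ U := isFrame_swap hU
  obtain ⟨h1, h2, h3⟩ := Vstep_Istep_pt hch hx hU' hI' hJ' hIi' hJi'
  -- the frame `I ⟨x, t₂, t₁, U⟩` is valid, so `V` commutes with the swap there
  have hregI' := hregI_of_valid (Pc := Pc) (nb := nb) hI'
  obtain ⟨hyS, -, -, -, -, -, -, -, -, -, -, hframe', -⟩ := Istep_spec hch hx hU' hregI'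
  have hPy := pattern_cases hch hyS
  have hVJ : (Vstep Pc nb (Jstep Pc nb ⟨x, t₁, t₂, U⟩)).pt = (Vstep Pc nb (Istep Pc nb ⟨x, t₂, t₁, U⟩)).pt := by
    rw [Jstep_swap]
    have h4 := congrArg ZFrame.pt (Vstep_swap (nb := nb) hPy hframe')
    exact h4
  rw [Vstep_swap hPx hU] at h1 h2 h3
  rw [hVJ]
  exact ⟨h1, h2, h3⟩
end Summit.AtomisticToContinuum.Crystallization.Theorems.PalmUnimodularRigidityShellsToBarlowChart.Clean

end
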